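import Literature.NumberTheory.Automorphic.Liu2021.AppendixC.EtaleFaltingsLevel
import Literature.NumberTheory.Automorphic.Liu2021.AppendixC.RestOneLevelInvariants
import Literature.NumberTheory.Automorphic.Liu2021.AppendixC.RestOneHecke
import Literature.NumberTheory.Automorphic.Liu2021.AppendixC.EtaleBettiComparison
import HarnessLib

/-!
# [Liu 2021, Thm 4.18 proof l. 2245–2263] in the colimit over levels, I: the map `Hom_E(A_∞, A_μ)_ℚ → Hom(ℚ_ℓ^{ac}·α, ℚ_ℓ^{ac} ⊗ H¹_ét(A_∞))`
# out of `Ω(μ) = colim_K Hom_E(A_K, A_μ)_ℚ` (tower bookkeeping on both sides)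

Topic `NumberTheory/Automorphic/Liu2021/AppendixC`; namespace `Literature.NumberTheory.Automorphic.Liu2021.AppendixC`.  Definitions
with bodies + theorems; no named fact, no `sorry`; net Literature debt 0.  Continuation of `EtaleFaltingsLevel.lean` (the level map `Φ_K`) over
the REAL carriers: `RestOne.ΩOne` / `HeckeTranslates.rhoΩOne` (the one-object `Ω(μ)` with its Hecke action, `RestOne.lean` / `RestOneHecke.lean`)
and `Sec42Data.etaleH1Tower` / `towerRep` / `EtaleHeckeDatum` / `EtaleHeckeDatum.IsInducedBy` (`EtaleH1Tower.lean`, `EtaleBettiComparison.lean`,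
B-typ04).  Cell `hodgecm-mathlib` (D-0151), line `a3-liu418` v3 (1b96ade3f8b6b529), stub F `stub_faltingsIsotypic` (KEY `a3-faltings-isotypic`,
seat A-p17): the final theorem `faltingsIsotypic_of_isInducedBy` has as conclusion the BODY of `Summit.….Lines.A3Liu418.FaltingsIsotypic T φ ι
hμ hw Car ℓ X ι'` (`Summits/…/HypLiu418/A3Liu418EtaleItems.lean`, p598646), so the skeleton's slot is filled BY NAME:
`theorem stub_faltingsIsotypic_of (hF) : StubFaltingsIsotypic := fun hDel F _ h6 ι₁ V a Φ hΦ ν hν hw ℓ _ X ι' hX =>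
faltingsIsotypic_of_isInducedBy (CV hDel F V Φ) (AlgHom.id ℚ _) ι₁ hν hw (CarN F ι₁ ν hν) ℓ ι' (TV hDel F h6 V Φ) X hX (fun K obj => hF _ _ ℓ)`
(slot test rc 0, axioms trio).  HC_CM is proved only modulo the 7 printed citations until rung 0 closes; this file is CONDITIONAL on the named
fact `Motives.faltings_tate_bijective` (VI-1) for the pairs `(A_K, A_μ)`, taken as the hypothesis `hF` — everything except the range clause
`⊇` is unconditional.

## The printed text (Y. Liu, arXiv:2102.11518, `FJcycle.tex` l. 2245–2263, print pp. 52–53)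

«we have a canonical isomorphism `Ω(μ) ⊗_{M_μ,ι_ℓ} ℚ_ℓ^{ac} ≃ Hom_{ℚ_ℓ^{ac}[Gal(ℂ/τ'(E))]}(ℚ_ℓ^{ac}·α, H¹_ét(A_μ ⊗_{E,τ'} ℂ, ℚ_ℓ^{ac}))`»
with `Ω(μ) = colim_K Hom_E(A_K, A_μ)_ℚ` (Rem. 4.17), `H¹_ét(A_∞) = colim_K H¹_ét(A_K)` (§4.3 l. 2158), and the `𝔾(𝔸_F^∞)`-actions on
both sides through the Hecke correspondences / translates (l. 2074, Def. 4.16 l. 2219).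

## Contents of I (this file) and II (`EtaleFaltingsIsotypic.lean`) (all PROVED; axioms `propext`, `Classical.choice`, `Quot.sound`)

* Tower side: `toTower_baseChange_comp_h1PullBar` (`[·]_{K'} ∘ Alb_u^* = [·]_K`), `exists_eq_toTower_baseChange` (every class of
  `ℚ_ℓ^{ac} ⊗ H¹_ét(A_∞)` lives at a small level), `towerRep_baseChange_comp_toTower` (Galois), `rhoEt_baseChange_comp_toTower`
  (Hecke, from `IsInducedBy`), `toTower_baseChange_injective` (flatness of `ℚ_ℓ^{ac}/ℚ_ℓ`).
* `Ω` side: `resOneₗ` (`res_K` at the chosen object, `M_μ`-linear), `exists_eq_resOne`, `exists_eq_lTensor_resOneₗ` (every element of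
  `ℂ ⊗_{M_μ} Ω(μ)` comes from ONE level below any threshold — directedness, `RestOne.isDirectedOrder_idx`).
* `towerHomModule` (the `M_μ`-structure on the target through `ι|_{M_μ}`, used with `letI` only), `faltingsTowerLevel` (+ `_apply`, `_sys`),
  `faltingsTower` = the map out of `colim_K` (`Module.DirectLimit.lift`; `faltingsTower_resOf`, `faltingsTower_smul`),
  `faltingsPsiAddHom`, **`faltingsPsi = Ψ`** (`ι`-semilinear; `faltingsPsi_tmul`, **`faltingsPsi_lTensor_resOneₗ`**: `Ψ ∘ (1 ⊗ res_K) = [·]_K ∘ Φ_K`).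
* **`faltingsPsi_injective`** (unconditional; uses an étale Hecke datum only through `levelCompat`), **`towerRep_faltingsPsi_apply`** (range ⊆),
  **`exists_faltingsPsi_eq`** (range ⊇, granted Faltings), **`faltingsPsi_rhoΩOne`** (`𝔾`-equivariance for `X` induced by `T`:
  `heckeRep_resOf` + `IsInducedBy`), and the assembly **`faltingsIsotypic_of_isInducedBy`** (conjunct (i) = `finrank_cmEigenline_eq_one`).

References: [Liu2021] Thm 4.18 proof l. 2245–2263, §4.2 l. 2070–2074, §4.3 l. 2158–2160, Def. 4.16, Rem. 4.17; [Faltings1983Endlichkeit] §5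
Satz 4, Korollar 1; [SerreTate1968] §4 Thm. 5 (i); [MumfordAV1970] §19 Thm. 3.
-/

noncomputable section

open CategoryTheory NumberField
open scoped TensorProduct

namespace Literature.NumberTheory.Automorphic.Liu2021.AppendixC

open Literature.AlgebraicGeometry.Motives (AbelianVariety faltings_tate_bijective faltings_rationalTate_bijective_of)
open Literature.AlgebraicGeometry.Motives.AbelianVariety (rationalTateModuleMap rationalTateModuleMap_comp rationalTateModuleMap_add
  rationalTateModuleMap_zero rationalTateModuleMap_id rationalTateRep_rationalTateModuleMap rationalTateAction rationalTateAction_of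
  rationalTateAction_algebraMap module_finite_tateModule_of_cast_ne_zero endAlgebra faltingsRationalTateMap rationalTateHom
  toLinearMap_rationalTateIntertwiningMap faltingsRationalTateMap_tmul)
open Literature.RepresentationTheory.IntertwiningBaseChange Literature.RepresentationTheory.IntertwiningDual

/-! ## §4 The colimit over levels: `Ψ : ℂ ⊗_{M_μ} Ω(μ) → Hom(ℚ_ℓ^{ac}·α, ℚ_ℓ^{ac} ⊗ H¹_ét(A_∞))` -/

section Tower

variable {F₀ E : Type} [Field F₀] [NumberField F₀] [IsTotallyReal F₀] [Field E] [NumberField E] [Algebra F₀ E]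
  [IsTotallyComplex E] [Algebra.IsQuadraticExtension F₀ E]
variable {P5 : PropC5Data F₀ E} {isotropicAt : ℕ → Prop} (C : Sec42Data P5 isotropicAt) (ℓ : ℕ) [Fact ℓ.Prime]

open RestOne (Idx)
open scoped Classical

/-! ### The étale side: level maps into `ℚ_ℓ^{ac} ⊗ H¹_ét(A_∞)` -/

/-- `[·]_{K'} ∘ (Alb_u)^* = [·]_K` on `ℚ_ℓ^{ac} ⊗ H¹_ét` for `K' ⊆ K` (`EtaleH1Tower.toTower_pull`, base-changed).
[cite: Liu2021, §4.3 (FJcycle.tex l. 2158)] -/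
theorem toTower_baseChange_comp_h1PullBar {K K' : C5.SmallLevel C.S.K₀} (f : K' ⟶ K) :
    (C.toTower ℓ K').baseChange (AlgebraicClosure ℚ_[ℓ]) ∘ₗ h1PullBar ℓ (C.Atr f) = (C.toTower ℓ K).baseChange (AlgebraicClosure ℚ_[ℓ]) := by
  rw [h1PullBar_def, ← LinearMap.baseChange_comp]
  congr 1
  exact LinearMap.ext (C.toTower_pull ℓ f)

/-- Every element of `ℚ_ℓ^{ac} ⊗ H¹_ét(A_∞)` is a level-`K` class, at a level `K` below any prescribed `K₁`.
[cite: Liu2021, §4.3 (FJcycle.tex l. 2158)] -/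
theorem exists_eq_toTower_baseChange (K₁ : C5.SmallLevel C.S.K₀) (v : AlgebraicClosure ℚ_[ℓ] ⊗[ℚ_[ℓ]] C.etaleH1Tower ℓ) :
    ∃ K : C5.SmallLevel C.S.K₀, K ≤ K₁ ∧ ∃ x, (C.toTower ℓ K).baseChange (AlgebraicClosure ℚ_[ℓ]) x = v := by
  haveI := RestOne.isDirectedOrder_idx C
  haveI := RestOne.nonempty_idx C
  induction v using TensorProduct.induction_on with
  | zero => exact ⟨K₁, le_rfl, 0, map_zero _⟩
  | tmul c e =>
    obtain ⟨i, e₀, he₀⟩ := Module.DirectLimit.exists_of (R := ℚ_[ℓ]) (ι := Idx C) (G := C.etSysObj ℓ) (f := C.etSys ℓ) e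
    obtain ⟨K, hKi, hK₁⟩ := C5.SmallLevel.exists_le_le (OrderDual.ofDual i) K₁
    refine ⟨K, hK₁, c ⊗ₜ ((rationalTateModuleMap ℓ (C.Atr (homOfLE hKi))).dualMap e₀), ?_⟩
    rw [LinearMap.baseChange_tmul, C.toTower_pull ℓ (homOfLE hKi)]
    exact congrArg _ he₀
  | add x y hx hy =>
    obtain ⟨K, hK, u, rfl⟩ := hx
    obtain ⟨K', hK', u', rfl⟩ := hy
    obtain ⟨M, hMK, hMK'⟩ := C5.SmallLevel.exists_le_le K K'
    refine ⟨M, hMK.trans hK, h1PullBar ℓ (C.Atr (homOfLE hMK)) u + h1PullBar ℓ (C.Atr (homOfLE hMK')) u', ?_⟩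
    rw [map_add, ← LinearMap.comp_apply, toTower_baseChange_comp_h1PullBar, ← LinearMap.comp_apply, toTower_baseChange_comp_h1PullBar]

/-- The Galois action on the tower restricted to a level: `(σ ⊗ 1) ∘ [·]_K = [·]_K ∘ (σ ⊗ 1)` (`EtaleH1Tower.towerRep_toTower`, base-changed).
[cite: Liu2021, §4.3 (FJcycle.tex l. 2158–2160)] -/
theorem towerRep_baseChange_comp_toTower (K : C5.SmallLevel C.S.K₀) (σ : Field.absoluteGaloisGroup E) :
    (C.towerRep ℓ σ).baseChange (AlgebraicClosure ℚ_[ℓ]) ∘ₗ (C.toTower ℓ K).baseChange (AlgebraicClosure ℚ_[ℓ]) =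
      (C.toTower ℓ K).baseChange (AlgebraicClosure ℚ_[ℓ]) ∘ₗ galoisH1Bar ℓ (C.A K) σ := by
  rw [galoisH1Bar, ← LinearMap.baseChange_comp, ← LinearMap.baseChange_comp]
  congr 1
  exact LinearMap.ext (C.towerRep_toTower ℓ K σ)

variable {C ℓ} in
/-- For an étale Hecke datum INDUCED by the translates `T` (`IsInducedBy`): `(g ⊗ 1) ∘ [·]_{K'} = [·]_K ∘ Alb(T_g)^*` on `ℚ_ℓ^{ac} ⊗ H¹_ét`.
[cite: Liu2021, §4.2 l. 2074 and §4.3 l. 2160] -/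
theorem rhoEt_baseChange_comp_toTower {X : C.EtaleHeckeDatum ℓ} {T : C.HeckeTranslates} (hX : X.IsInducedBy T) (g : C.G)
    (K K' : C5.SmallLevel C.S.K₀) (h : C5.HeckeLE g K K') :
    (X.rhoEt g).baseChange (AlgebraicClosure ℚ_[ℓ]) ∘ₗ (C.toTower ℓ K').baseChange (AlgebraicClosure ℚ_[ℓ]) =
      (C.toTower ℓ K).baseChange (AlgebraicClosure ℚ_[ℓ]) ∘ₗ h1PullBar ℓ (T.albTr g K K' h) := by
  rw [h1PullBar_def, ← LinearMap.baseChange_comp, ← LinearMap.baseChange_comp]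
  congr 1
  exact LinearMap.ext (hX g K K' h)

/-- Below the threshold of `EtaleHeckeDatum.levelCompat`, `[·]_K ⊗ ℚ_ℓ^{ac}` is injective (`ℚ_ℓ^{ac}` is flat over `ℚ_ℓ`).
[cite: Liu2021, Thm 4.18 (1) (FJcycle.tex l. 2239) and §4.3 l. 2158] -/
theorem toTower_baseChange_injective {K : C5.SmallLevel C.S.K₀} (hK : Function.Injective (C.toTower ℓ K)) :
    Function.Injective ((C.toTower ℓ K).baseChange (AlgebraicClosure ℚ_[ℓ])) := by
  have h := Module.Flat.lTensor_preserves_injective_linearMap (M := AlgebraicClosure ℚ_[ℓ]) (C.toTower ℓ K) hK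
  intro a b hab
  exact h hab

end Tower

section Colimit

variable {F₀ E : Type} [Field F₀] [NumberField F₀] [IsTotallyReal F₀] [Field E] [NumberField E] [Algebra F₀ E]
  [IsTotallyComplex E] [Algebra.IsQuadraticExtension F₀ E] [IsCMField E]
variable {P5 : PropC5Data F₀ E} {isotropicAt : ℕ → Prop} (C : Sec42Data P5 isotropicAt)
variable {L : Type} [Field L] [NumberField L] [IsGalois ℚ L] (φ : E →ₐ[ℚ] L) (ιE : L →+* ℂ)
variable {μ : IdeleClassGroup E →ₜ* Circle} (hμ : IdeleClassGroup.IsConjugateSymplectic E μ)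
  (hw : IdeleClassGroup.HasWeight E μ 1) (Car : Def45.Carriers E μ)
variable (obj : RestOne.ObjOne φ ιE hμ hw Car) (ℓ : ℕ) [Fact ℓ.Prime] (ι : ℂ ≃+* AlgebraicClosure ℚ_[ℓ])

open RestOne (QHom AμOne iOne ObjOne ofFieldOfValues ΩOne ΩOf resOf resOne Idx sysObj sys pre preₛ)
open scoped Literature.NumberTheory.Automorphic.Liu2021.AppendixC.RestOne
open scoped Classical

/-- `res_K` at the chosen object, as an `M_μ`-LINEAR map `ℚ ⊗ Hom_E(A_K, A_μ) → Ω(μ)` (the additive `RestOne.resOne` with its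
`M_μ`-linearity, which holds factorwise for `Module.DirectLimit.of`). [cite: Liu2021, §4.2 (FJcycle.tex l. 2070–2072)] -/
def resOneₗ (K : C5.SmallLevel C.S.K₀) : C.HomQ K (AμOne φ ιE hμ hw Car obj) →ₗ[fieldOfValues E μ] ΩOne C φ ιE hμ hw Car :=
  { resOne C φ ιE hμ hw Car K obj with
    map_smul' := fun s t => funext fun D' => by
      change resOf C (AμOne φ ιE hμ hw Car D') (fieldOfValues E μ) K (s • t) = s • resOf C (AμOne φ ιE hμ hw Car D') (fieldOfValues E μ) K t
      exact (Module.DirectLimit.of (fieldOfValues E μ) (Idx C) (sysObj C (AμOne φ ιE hμ hw Car D'))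
        (sys C (AμOne φ ιE hμ hw Car D') (fieldOfValues E μ)) (OrderDual.toDual K)).map_smul s t }

/-- `resOneₗ K t = resOne K obj t`. [cite: Liu2021, §4.2 (FJcycle.tex l. 2070–2072)] -/
theorem resOneₗ_apply (K : C5.SmallLevel C.S.K₀) (t : C.HomQ K (AμOne φ ιE hμ hw Car obj)) :
    resOneₗ C φ ιE hμ hw Car obj K t = resOne C φ ιE hμ hw Car K obj t :=
  rfl

/-- `resOneₗ K' ∘ u^* = resOneₗ K` for `K' ⊆ K` (`RestOne.resOne_pull`). [cite: Liu2021, §4.2 (FJcycle.tex l. 2070–2072)] -/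
theorem resOneₗ_comp_pre {K K' : C5.SmallLevel C.S.K₀} (f : K' ⟶ K) :
    resOneₗ C φ ιE hμ hw Car obj K' ∘ₗ preₛ (AμOne φ ιE hμ hw Car obj) (fieldOfValues E μ) (C.Atr f) =
      resOneₗ C φ ιE hμ hw Car obj K := by
  refine LinearMap.ext fun t => ?_
  rw [LinearMap.comp_apply, resOneₗ_apply, resOneₗ_apply, RestOne.preₛ_apply, ← RestOne.pull_eq_pre]
  exact RestOne.resOne_pull C φ ιE hμ hw Car f obj t

/-- Every element of `Ω(μ)` at the one object is a level-`K` class `res_K(t)`, at a level `K` below any prescribed `K₁`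
(directedness of the levels, `Module.DirectLimit.exists_of`; `ObjOne` is a subsingleton). [cite: Liu2021, §4.2 (FJcycle.tex l. 2070–2072); Rem. 4.17] -/
theorem exists_eq_resOne (K₁ : C5.SmallLevel C.S.K₀) (x : ΩOne C φ ιE hμ hw Car) :
    ∃ K : C5.SmallLevel C.S.K₀, K ≤ K₁ ∧ ∃ t, x = resOne C φ ιE hμ hw Car K obj t := by
  haveI := RestOne.isDirectedOrder_idx C
  haveI := RestOne.nonempty_idx C
  obtain ⟨i, t₀, ht₀⟩ := Module.DirectLimit.exists_of (R := fieldOfValues E μ) (ι := Idx C)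
    (G := sysObj C (AμOne φ ιE hμ hw Car obj)) (f := sys C (AμOne φ ιE hμ hw Car obj) (fieldOfValues E μ)) (x obj)
  obtain ⟨K, hKi, hK₁⟩ := C5.SmallLevel.exists_le_le (OrderDual.ofDual i) K₁
  refine ⟨K, hK₁, Sec42Data.HomQ.pull C (homOfLE hKi) _ t₀, funext fun D' => ?_⟩
  obtain rfl : D' = obj := Subsingleton.elim _ _
  rw [RestOne.resOne_pull]
  exact ht₀.symm

/-- Every element of `ℂ ⊗_{M_μ} Ω(μ)` comes from `ℂ ⊗_{M_μ} (ℚ ⊗ Hom_E(A_K, A_μ))` at a single level `K` below any prescribed `K₁`.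
[cite: Liu2021, §4.2 (FJcycle.tex l. 2070–2072); Rem. 4.17] -/
theorem exists_eq_lTensor_resOneₗ (K₁ : C5.SmallLevel C.S.K₀) (w : ℂ ⊗[fieldOfValues E μ] ΩOne C φ ιE hμ hw Car) :
    ∃ K : C5.SmallLevel C.S.K₀, K ≤ K₁ ∧ ∃ u, w = (resOneₗ C φ ιE hμ hw Car obj K).lTensor ℂ u := by
  induction w using TensorProduct.induction_on with
  | zero => exact ⟨K₁, le_rfl, 0, (map_zero _).symm⟩
  | tmul z x =>
    obtain ⟨K, hK, t, rfl⟩ := exists_eq_resOne C φ ιE hμ hw Car obj K₁ x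
    exact ⟨K, hK, z ⊗ₜ t, by rw [LinearMap.lTensor_tmul, resOneₗ_apply]⟩
  | add x y hx hy =>
    obtain ⟨K, hK, u, rfl⟩ := hx
    obtain ⟨K', hK', u', rfl⟩ := hy
    obtain ⟨M, hMK, hMK'⟩ := C5.SmallLevel.exists_le_le K K'
    refine ⟨M, hMK.trans hK, (preₛ (AμOne φ ιE hμ hw Car obj) (fieldOfValues E μ) (C.Atr (homOfLE hMK))).lTensor ℂ u +
      (preₛ (AμOne φ ιE hμ hw Car obj) (fieldOfValues E μ) (C.Atr (homOfLE hMK'))).lTensor ℂ u', ?_⟩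
    rw [map_add, ← LinearMap.comp_apply, ← LinearMap.lTensor_comp, resOneₗ_comp_pre, ← LinearMap.comp_apply, ← LinearMap.lTensor_comp,
      resOneₗ_comp_pre]

/-! ### The map `Ψ` -/

/-- The `M_μ`-module structure on `Hom(ℚ_ℓ^{ac}·α, ℚ_ℓ^{ac} ⊗ H¹_ét(A_∞))` through `ι|_{M_μ} : M_μ ⊆ ℂ ≅ ℚ_ℓ^{ac}` («`⊗_{M_μ,ι_ℓ} ℚ_ℓ^{ac}`»,
l. 2258; Mathlib `Module.compHom`; a definition used locally with `letI`, never an instance). [cite: Liu2021, Thm 4.18 proof (FJcycle.tex l. 2258)] -/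
@[reducible] def towerHomModule : Module (fieldOfValues E μ)
    (cmEigenline ℓ (AμOne φ ιE hμ hw Car obj) (IdeleClassGroup.muAlgValueField E μ) (iOne φ ιE hμ hw Car obj) ι →ₗ[AlgebraicClosure ℚ_[ℓ]]
      AlgebraicClosure ℚ_[ℓ] ⊗[ℚ_[ℓ]] C.etaleH1Tower ℓ) :=
  Module.compHom _ (ι.toRingHom.comp (algebraMap (fieldOfValues E μ) ℂ))

/-- The level-`K` component `t ↦ [·]_K ∘ Φ_K(1 ⊗ t)` of the map out of the colimit, `M_μ`-linear for `towerHomModule`.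
[cite: Liu2021, Thm 4.18 proof (FJcycle.tex l. 2254–2262)] -/
def faltingsTowerLevel (i : Idx C) :
    letI := towerHomModule C φ ιE hμ hw Car obj ℓ ι
    sysObj C (AμOne φ ιE hμ hw Car obj) i →ₗ[fieldOfValues E μ]
      (cmEigenline ℓ (AμOne φ ιE hμ hw Car obj) (IdeleClassGroup.muAlgValueField E μ) (iOne φ ιE hμ hw Car obj) ι →ₗ[AlgebraicClosure ℚ_[ℓ]]
        AlgebraicClosure ℚ_[ℓ] ⊗[ℚ_[ℓ]] C.etaleH1Tower ℓ) :=
  letI := towerHomModule C φ ιE hμ hw Car obj ℓ ι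
  { toFun := fun t => (C.toTower ℓ (OrderDual.ofDual i)).baseChange (AlgebraicClosure ℚ_[ℓ]) ∘ₗ
      faltingsLevel φ ιE hμ hw Car obj ℓ ι (C.A (OrderDual.ofDual i)) ((1 : ℂ) ⊗ₜ t)
    map_add' := fun t t' => by rw [TensorProduct.tmul_add, map_add, LinearMap.comp_add]
    map_smul' := fun s t => by
      have hs : ((1 : ℂ) ⊗ₜ[fieldOfValues E μ] (s • t) : ℂ ⊗[fieldOfValues E μ] C.HomQ (OrderDual.ofDual i) (AμOne φ ιE hμ hw Car obj)) =
          (algebraMap (fieldOfValues E μ) ℂ s) • ((1 : ℂ) ⊗ₜ[fieldOfValues E μ] t) := by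
        rw [← TensorProduct.smul_tmul, Algebra.smul_def, mul_one, TensorProduct.smul_tmul', smul_eq_mul, mul_one]
      change (C.toTower ℓ (OrderDual.ofDual i)).baseChange (AlgebraicClosure ℚ_[ℓ]) ∘ₗ
          faltingsLevel φ ιE hμ hw Car obj ℓ ι (C.A (OrderDual.ofDual i)) ((1 : ℂ) ⊗ₜ (s • t)) =
        ι (algebraMap (fieldOfValues E μ) ℂ s) • ((C.toTower ℓ (OrderDual.ofDual i)).baseChange (AlgebraicClosure ℚ_[ℓ]) ∘ₗ
          faltingsLevel φ ιE hμ hw Car obj ℓ ι (C.A (OrderDual.ofDual i)) ((1 : ℂ) ⊗ₜ t))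
      rw [hs, faltingsLevel_smul, LinearMap.comp_smul] }

/-- unfolding of the level components. [cite: Liu2021, Thm 4.18 proof (FJcycle.tex l. 2254–2262)] -/
theorem faltingsTowerLevel_apply (i : Idx C) (t : sysObj C (AμOne φ ιE hμ hw Car obj) i) :
    faltingsTowerLevel C φ ιE hμ hw Car obj ℓ ι i t = (C.toTower ℓ (OrderDual.ofDual i)).baseChange (AlgebraicClosure ℚ_[ℓ]) ∘ₗ
      faltingsLevel φ ιE hμ hw Car obj ℓ ι (C.A (OrderDual.ofDual i)) ((1 : ℂ) ⊗ₜ t) :=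
  rfl

/-- The level components are compatible with the transitions `Alb_u^*` (`[·]_{K'} ∘ Alb_u^* = [·]_K`).
[cite: Liu2021, Thm 4.18 proof (FJcycle.tex l. 2254–2262); §4.3 l. 2158] -/
theorem faltingsTowerLevel_sys (i j : Idx C) (hij : i ≤ j) (t : sysObj C (AμOne φ ιE hμ hw Car obj) i) :
    faltingsTowerLevel C φ ιE hμ hw Car obj ℓ ι j (sys C (AμOne φ ιE hμ hw Car obj) (fieldOfValues E μ) i j hij t) =
      faltingsTowerLevel C φ ιE hμ hw Car obj ℓ ι i t := by
  refine LinearMap.ext fun y => ?_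
  rw [faltingsTowerLevel_apply, faltingsTowerLevel_apply]
  change ((C.toTower ℓ (OrderDual.ofDual j)).baseChange (AlgebraicClosure ℚ_[ℓ]) ∘ₗ
      faltingsLevel φ ιE hμ hw Car obj ℓ ι (C.A (OrderDual.ofDual j))
        ((1 : ℂ) ⊗ₜ pre (AμOne φ ιE hμ hw Car obj) (C.Atr (homOfLE (show OrderDual.ofDual j ≤ OrderDual.ofDual i from hij))) t)) y =
    ((C.toTower ℓ (OrderDual.ofDual i)).baseChange (AlgebraicClosure ℚ_[ℓ]) ∘ₗ
      faltingsLevel φ ιE hμ hw Car obj ℓ ι (C.A (OrderDual.ofDual i)) ((1 : ℂ) ⊗ₜ t)) y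
  rw [LinearMap.comp_apply, LinearMap.comp_apply, faltingsLevel_tmul_pre_apply, ← LinearMap.comp_apply,
    toTower_baseChange_comp_h1PullBar]

/-- **`Hom_E(A_∞, A_μ)_ℚ → Hom(ℚ_ℓ^{ac}·α, ℚ_ℓ^{ac} ⊗ H¹_ét(A_∞))`, `res_K(t) ↦ [·]_K ∘ (t^*)|_{ℚ_ℓ^{ac}·α}`** — the map of l. 2254–2258 out
of the colimit `Ω(μ) = colim_K Hom_E(A_K, A_μ)_ℚ` (`Module.DirectLimit.lift` of the level components), additive (and `M_μ`-semilinear along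
`ι|_{M_μ}`, `faltingsTower_smul`). [cite: Liu2021, Thm 4.18 proof (FJcycle.tex l. 2254–2262)] -/
def faltingsTower : ΩOf C (AμOne φ ιE hμ hw Car obj) (fieldOfValues E μ) →+
    (cmEigenline ℓ (AμOne φ ιE hμ hw Car obj) (IdeleClassGroup.muAlgValueField E μ) (iOne φ ιE hμ hw Car obj) ι →ₗ[AlgebraicClosure ℚ_[ℓ]]
      AlgebraicClosure ℚ_[ℓ] ⊗[ℚ_[ℓ]] C.etaleH1Tower ℓ) :=
  letI := towerHomModule C φ ιE hμ hw Car obj ℓ ι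
  (Module.DirectLimit.lift (fieldOfValues E μ) (Idx C) (sysObj C (AμOne φ ιE hμ hw Car obj))
    (sys C (AμOne φ ιE hμ hw Car obj) (fieldOfValues E μ)) (faltingsTowerLevel C φ ιE hμ hw Car obj ℓ ι)
    (faltingsTowerLevel_sys C φ ιE hμ hw Car obj ℓ ι)).toAddMonoidHom

/-- `faltingsTower (res_K t) = [·]_K ∘ Φ_K(1 ⊗ t)`. [cite: Liu2021, Thm 4.18 proof (FJcycle.tex l. 2254–2262)] -/
theorem faltingsTower_resOf (K : C5.SmallLevel C.S.K₀) (t : C.HomQ K (AμOne φ ιE hμ hw Car obj)) :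
    faltingsTower C φ ιE hμ hw Car obj ℓ ι (resOf C (AμOne φ ιE hμ hw Car obj) (fieldOfValues E μ) K t) =
      (C.toTower ℓ K).baseChange (AlgebraicClosure ℚ_[ℓ]) ∘ₗ faltingsLevel φ ιE hμ hw Car obj ℓ ι (C.A K) ((1 : ℂ) ⊗ₜ t) := by
  letI := towerHomModule C φ ιE hμ hw Car obj ℓ ι
  show (Module.DirectLimit.lift (fieldOfValues E μ) (Idx C) (sysObj C (AμOne φ ιE hμ hw Car obj))
      (sys C (AμOne φ ιE hμ hw Car obj) (fieldOfValues E μ)) (faltingsTowerLevel C φ ιE hμ hw Car obj ℓ ι)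
      (faltingsTowerLevel_sys C φ ιE hμ hw Car obj ℓ ι))
    (Module.DirectLimit.of (fieldOfValues E μ) (Idx C) (sysObj C (AμOne φ ιE hμ hw Car obj))
      (sys C (AμOne φ ιE hμ hw Car obj) (fieldOfValues E μ)) (OrderDual.toDual K) t) = _
  rw [Module.DirectLimit.lift_of]
  rfl

/-- `faltingsTower` is `M_μ`-semilinear along `ι|_{M_μ}`: `s · x ↦ ι(s) · (…)`. [cite: Liu2021, Thm 4.18 proof (FJcycle.tex l. 2254–2262)] -/
theorem faltingsTower_smul (s : fieldOfValues E μ) (x : ΩOf C (AμOne φ ιE hμ hw Car obj) (fieldOfValues E μ)) :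
    faltingsTower C φ ιE hμ hw Car obj ℓ ι (s • x) = ι (s : ℂ) • faltingsTower C φ ιE hμ hw Car obj ℓ ι x := by
  haveI := RestOne.isDirectedOrder_idx C
  haveI := RestOne.nonempty_idx C
  induction x using Module.DirectLimit.induction_on with
  | ih i t =>
    rw [← LinearMap.map_smul]
    change faltingsTower C φ ιE hμ hw Car obj ℓ ι (resOf C _ _ (OrderDual.ofDual i) (s • t)) =
      ι (s : ℂ) • faltingsTower C φ ιE hμ hw Car obj ℓ ι (resOf C _ _ (OrderDual.ofDual i) t)
    have hs : ((1 : ℂ) ⊗ₜ[fieldOfValues E μ] (s • t) : ℂ ⊗[fieldOfValues E μ] C.HomQ (OrderDual.ofDual i) (AμOne φ ιE hμ hw Car obj)) =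
        (s : ℂ) • ((1 : ℂ) ⊗ₜ[fieldOfValues E μ] t) := by
      rw [← TensorProduct.smul_tmul, Algebra.smul_def, mul_one, TensorProduct.smul_tmul', smul_eq_mul, mul_one]
      rfl
    rw [faltingsTower_resOf, faltingsTower_resOf, hs, faltingsLevel_smul, LinearMap.comp_smul]

end Colimit

end Literature.NumberTheory.Automorphic.Liu2021.AppendixC

end
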